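import Mathlib
import Literature.LinearAlgebra.Matrix.SpecialLinearReductionSurjective
import Summits.BirchSwinnertonDyer.BirchSwinnertonDyer.Theorems.KatoDescentTamePotSupersingularTameLowerFibreAdjointBricksFiveDet

/-!
# Bricks for the `GL₂(𝔽₅)`-lifting route (T5′), XIV: `S^μ` lifts along `ℤ/5^a → ℤ/5^b`, and the
# instance-free description of the image of `S^μ(ℤ/5^{m+1})`

Continuation of the family `…TameLowerFibreAdjointBricksFive*` (same namespace). Two bookkeeping pieces for
the passage to the limit (h) of ARM-P r07 S7 ADD-1 §C (file XV):

* `exists_smu_map_eq_of_le` — **`S^μ(ℤ/5^a) → S^μ(ℤ/5^b)` is onto (`1 ≤ b ≤ a`)**, `S^μ = {(det)⁴ = 1}`: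
  the `SL₂` part lifts through `SL₂(ℤ)` (Andrianov–Zhuravlev, Literature `IntegerSpecialLinear`), the
  determinant `δ ∈ μ₄(ℤ/5^b)` lifts to the Teichmüller-type unit `D = D₀^{5^a}` (`D ≡ δ` as `5^a ≡ 1 (mod 4)`,
  `D⁴ = D₀^{5·φ(5^a)} = 1`). File IV proved the one-step case inline; this is the statement for any `b ≤ a`.
* `exists_smu_castHom_eq_of_intCast` / `intCast_of_castHom` — over a ring `R` of characteristic `5^{m+1}`,
  an invertible matrix is the image of an element of `S^μ(ℤ/5^{m+1})` iff its entries are (images of)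
  integers and `(det)⁴ = 1`: the INSTANCE-FREE currency in which file XV states «`u · S^μ(closure of ℤ) · u⁻¹ ⊆ G`».

Route-free, no definitions, nothing about elliptic curves or items 19618/19981 (open). Target T-S7r07-1.
-/

set_option linter.dupNamespace false

open Matrix

namespace Summit.BirchSwinnertonDyer.BirchSwinnertonDyer.Theorems.GL2F5AdjointBricks

section smulift

/-- **`S^μ(ℤ/5^a) → S^μ(ℤ/5^b)` is onto for `1 ≤ b ≤ a`.** Every `q ∈ GL₂(ℤ/5^b)` with `(det q)⁴ = 1` is the
reduction of some `g ∈ GL₂(ℤ/5^a)` with `(det g)⁴ = 1`. -/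
theorem exists_smu_map_eq_of_le (a b : ℕ) (hb : 1 ≤ b) (hab : b ≤ a) (q : GL (Fin 2) (ZMod (5 ^ b)))
    (hq : Matrix.det (q : Matrix (Fin 2) (Fin 2) (ZMod (5 ^ b))) ^ 4 = 1) :
    ∃ g : GL (Fin 2) (ZMod (5 ^ a)), Matrix.det (g : Matrix (Fin 2) (Fin 2) (ZMod (5 ^ a))) ^ 4 = 1 ∧
      Matrix.GeneralLinearGroup.map (ZMod.castHom (pow_dvd_pow 5 hab) (ZMod (5 ^ b))) g = q := by
  classical
  haveI : NeZero (5 ^ a) := ⟨pow_ne_zero _ (by norm_num)⟩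
  haveI : NeZero (5 ^ b) := ⟨pow_ne_zero _ (by norm_num)⟩
  set cm := ZMod.castHom (pow_dvd_pow 5 hab) (ZMod (5 ^ b)) with hcm
  -- the determinant `δ ∈ μ₄(ℤ/5^b)` and the `SL₂` part
  set u : (ZMod (5 ^ b))ˣ := Matrix.GeneralLinearGroup.det q with hu
  have hu_val : (u : ZMod (5 ^ b)) = Matrix.det (q : Matrix (Fin 2) (Fin 2) (ZMod (5 ^ b))) := by
    rw [hu, Matrix.GeneralLinearGroup.val_det_apply]
  have hu4 : (u : ZMod (5 ^ b)) ^ 4 = 1 := by rw [hu_val, hq]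
  have hs₁det : Matrix.det (!![((u⁻¹ : (ZMod (5 ^ b))ˣ) : ZMod (5 ^ b)), 0; 0, 1] *
      (q : Matrix (Fin 2) (Fin 2) (ZMod (5 ^ b)))) = 1 := by
    rw [Matrix.det_mul, Matrix.det_fin_two_of, ← hu_val, mul_one, mul_zero, sub_zero, Units.inv_mul]
  set s₁ : Matrix.SpecialLinearGroup (Fin 2) (ZMod (5 ^ b)) :=
    ⟨!![((u⁻¹ : (ZMod (5 ^ b))ˣ) : ZMod (5 ^ b)), 0; 0, 1] * (q : Matrix (Fin 2) (Fin 2) (ZMod (5 ^ b))),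
      hs₁det⟩ with hs₁
  -- lift the `SL₂` part through `SL₂(ℤ)`
  obtain ⟨S, hS⟩ : ∃ S : Matrix.SpecialLinearGroup (Fin 2) (ZMod (5 ^ a)),
      Matrix.SpecialLinearGroup.map cm S = s₁ := by
    obtain ⟨V, hV⟩ :=
      Literature.LinearAlgebra.Matrix.IntegerSpecialLinear.exists_specialLinearGroup_map_intCast_eq (5 ^ b) s₁
    refine ⟨Matrix.SpecialLinearGroup.map (Int.castRingHom (ZMod (5 ^ a))) V, ?_⟩
    rw [← hV]
    apply Subtype.ext
    ext i j
    simp only [hcm, Matrix.SpecialLinearGroup.map_apply_coe, RingHom.mapMatrix_apply, Matrix.map_apply,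
      eq_intCast, map_intCast]
  have hSentry : ∀ i j, cm ((S : Matrix (Fin 2) (Fin 2) (ZMod (5 ^ a))) i j) =
      (s₁ : Matrix (Fin 2) (Fin 2) (ZMod (5 ^ b))) i j := by
    intro i j
    have h := congrArg (fun x : Matrix.SpecialLinearGroup (Fin 2) (ZMod (5 ^ b)) =>
      (x : Matrix (Fin 2) (Fin 2) (ZMod (5 ^ b))) i j) hS
    simpa only [Matrix.SpecialLinearGroup.map_apply_coe, RingHom.mapMatrix_apply, Matrix.map_apply] using h
  -- lift the determinant: `D = D₀^{5^a}` with `D₀` the canonical lift of `δ` (a unit)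
  set D₀ : ZMod (5 ^ a) := (((u : ZMod (5 ^ b)).val : ℕ) : ZMod (5 ^ a)) with hD₀
  have hD₀red : cm D₀ = u := by rw [hD₀, map_natCast, ZMod.natCast_zmod_val]
  have hD₀unit : IsUnit D₀ := by
    rw [hD₀, ZMod.isUnit_iff_coprime]
    have hcop : Nat.Coprime ((u : ZMod (5 ^ b)).val) (5 ^ b) := ZMod.val_coe_unit_coprime u
    obtain ⟨b', rfl⟩ : ∃ b', b = b' + 1 := ⟨b - 1, by omega⟩
    have h5 : Nat.Coprime ((u : ZMod (5 ^ (b' + 1))).val) 5 :=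
      Nat.Coprime.coprime_dvd_right (dvd_pow_self 5 (Nat.succ_ne_zero b')) hcop
    exact Nat.Coprime.pow_right a h5
  obtain ⟨d₀, hd₀⟩ := hD₀unit
  set D : ZMod (5 ^ a) := D₀ ^ (5 ^ a) with hD
  have hDred : cm D = u := by
    rw [hD, map_pow, hD₀red]
    have h54 : 5 ^ a % 4 = 1 := by
      rw [Nat.pow_mod]; norm_num
    have hdiv : 5 ^ a = 4 * (5 ^ a / 4) + 1 := by omega
    rw [hdiv, pow_succ, pow_mul, hu4, one_pow, one_mul]
  have hD4 : D ^ 4 = 1 := by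
    obtain ⟨a', rfl⟩ : ∃ a', a = a' + 1 := ⟨a - 1, by omega⟩
    have htot : (d₀ : ZMod (5 ^ (a' + 1))) ^ Nat.totient (5 ^ (a' + 1)) = 1 := by
      have h := ZMod.pow_totient d₀
      have h' := congrArg (fun x : (ZMod (5 ^ (a' + 1)))ˣ => (x : ZMod (5 ^ (a' + 1)))) h
      simpa only [Units.val_pow_eq_pow_val, Units.val_one] using h'
    rw [Nat.totient_prime_pow (by norm_num : Nat.Prime 5) (Nat.succ_pos a')] at htot
    rw [hD, ← hd₀, ← pow_mul,
      show 5 ^ (a' + 1) * 4 = 5 ^ (a' + 1 - 1) * (5 - 1) * 5 by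
        rw [Nat.add_sub_cancel, pow_succ]; ring,
      pow_mul, htot, one_pow]
  have hD13 : D * D ^ 3 = 1 := by rw [← pow_succ' D 3, hD4]
  have hD31 : D ^ 3 * D = 1 := by rw [← pow_succ D 3, hD4]
  set T : GL (Fin 2) (ZMod (5 ^ a)) :=
    ⟨!![D, 0; 0, 1], !![D ^ 3, 0; 0, 1],
      by rw [Matrix.mul_fin_two, Matrix.one_fin_two]; simp [hD13],
      by rw [Matrix.mul_fin_two, Matrix.one_fin_two]; simp [hD31]⟩ with hT
  have hTval : T.val = !![D, 0; 0, 1] := rfl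
  refine ⟨T * Matrix.SpecialLinearGroup.toGL S, ?_, ?_⟩
  · -- `det (T S) = D ∈ μ₄`
    rw [Units.val_mul, Matrix.det_mul, Matrix.SpecialLinearGroup.coe_GL_coe_matrix, S.prop, mul_one, hTval,
      Matrix.det_fin_two_of, mul_one, mul_zero, sub_zero, hD4]
  · -- reduction: `diag(δ, 1) · diag(δ⁻¹, 1) · q = q`
    apply Units.ext
    ext i j
    rw [Matrix.GeneralLinearGroup.map_apply, Units.val_mul, hTval, Matrix.SpecialLinearGroup.coe_GL_coe_matrix]
    have hs₁val : (s₁ : Matrix (Fin 2) (Fin 2) (ZMod (5 ^ b))) =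
        !![((u⁻¹ : (ZMod (5 ^ b))ˣ) : ZMod (5 ^ b)), 0; 0, 1] * (q : Matrix (Fin 2) (Fin 2) (ZMod (5 ^ b))) := rfl
    have e00 := hSentry 0 j
    have e10 := hSentry 1 j
    rw [hs₁val] at e00 e10
    simp only [Matrix.mul_apply, Fin.sum_univ_two, Matrix.of_apply, Matrix.cons_val', Matrix.cons_val_zero,
      Matrix.cons_val_one, Matrix.empty_val', Matrix.cons_val_fin_one, Fin.isValue, zero_mul, add_zero,
      one_mul, zero_add] at e00 e10
    fin_cases i
    · simp only [Matrix.mul_apply, Fin.sum_univ_two, Matrix.of_apply, Matrix.cons_val', Matrix.cons_val_zero,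
        Matrix.cons_val_one, Matrix.empty_val', Matrix.cons_val_fin_one, Fin.isValue, Fin.zero_eta, zero_mul,
        add_zero, map_mul, hDred, e00, ← mul_assoc, Units.mul_inv, one_mul]
    · simp only [Matrix.mul_apply, Fin.sum_univ_two, Matrix.of_apply, Matrix.cons_val', Matrix.cons_val_zero,
        Matrix.cons_val_one, Matrix.empty_val', Matrix.cons_val_fin_one, Fin.isValue, Fin.mk_one, zero_mul,
        zero_add, one_mul, e10]

end smulift

section intcast

variable {R : Type*} [CommRing R]

/-- Over a ring of characteristic `5^{m+1}`, an invertible matrix with INTEGER entries and `(det)⁴ = 1` is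
the image of an element of `S^μ(ℤ/5^{m+1})` (the structure map `ℤ/5^{m+1} → R` being injective). -/
theorem exists_smu_castHom_eq_of_intCast (m : ℕ) [CharP R (5 ^ (m + 1))] (w : GL (Fin 2) R)
    (hw : ∀ i j, ∃ z : ℤ, w.val i j = z) (hdet : Matrix.det (w : Matrix (Fin 2) (Fin 2) R) ^ 4 = 1) :
    ∃ g : GL (Fin 2) (ZMod (5 ^ (m + 1))), Matrix.det (g : Matrix (Fin 2) (Fin 2) (ZMod (5 ^ (m + 1)))) ^ 4 = 1 ∧
      Matrix.GeneralLinearGroup.map (ZMod.castHom (dvd_refl (5 ^ (m + 1))) R) g = w := by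
  classical
  set cast := ZMod.castHom (dvd_refl (5 ^ (m + 1))) R with hcast
  have hinj : Function.Injective cast := ZMod.castHom_injective R
  choose z hz using hw
  set Z : Matrix (Fin 2) (Fin 2) (ZMod (5 ^ (m + 1))) := Matrix.of fun i j => ((z i j : ℤ) : ZMod (5 ^ (m + 1)))
    with hZ
  have hZw : Z.map cast = w.val := by
    ext i j; simp only [Matrix.map_apply, hZ, Matrix.of_apply, map_intCast, hz]
  have hdetZ : cast (Matrix.det Z) = Matrix.det w.val := by
    rw [RingHom.map_det, RingHom.mapMatrix_apply, hZw]
  have hdetZ4 : Matrix.det Z ^ 4 = 1 := by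
    apply hinj; rw [map_pow, hdetZ, hdet, map_one]
  have hunit : IsUnit (Matrix.det Z) :=
    IsUnit.of_mul_eq_one (Matrix.det Z ^ 3) (by rw [← pow_succ', hdetZ4])
  refine ⟨Matrix.GeneralLinearGroup.mk'' Z hunit, hdetZ4, Units.ext ?_⟩
  exact hZw

/-- Conversely, the image of `g ∈ S^μ(ℤ/5^{m+1})` has integer entries and `(det)⁴ = 1`. -/
theorem intCast_of_smu_castHom (m : ℕ) [CharP R (5 ^ (m + 1))] (g : GL (Fin 2) (ZMod (5 ^ (m + 1))))
    (hg : Matrix.det (g : Matrix (Fin 2) (Fin 2) (ZMod (5 ^ (m + 1)))) ^ 4 = 1) :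
    (∀ i j, ∃ z : ℤ, (Matrix.GeneralLinearGroup.map (ZMod.castHom (dvd_refl (5 ^ (m + 1))) R) g).val i j = z) ∧
      Matrix.det ((Matrix.GeneralLinearGroup.map (ZMod.castHom (dvd_refl (5 ^ (m + 1))) R) g :
        GL (Fin 2) R) : Matrix (Fin 2) (Fin 2) R) ^ 4 = 1 := by
  haveI : NeZero (5 ^ (m + 1)) := ⟨pow_ne_zero _ (by norm_num)⟩
  constructor
  · intro i j
    refine ⟨((g.val i j).val : ℤ), ?_⟩
    rw [Matrix.GeneralLinearGroup.map_apply, Int.cast_natCast, ← map_natCast (ZMod.castHom (dvd_refl (5 ^ (m + 1))) R),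
      ZMod.natCast_zmod_val]
  · have hd : Matrix.det ((Matrix.GeneralLinearGroup.map (ZMod.castHom (dvd_refl (5 ^ (m + 1))) R) g : GL (Fin 2) R) :
        Matrix (Fin 2) (Fin 2) R) = ZMod.castHom (dvd_refl (5 ^ (m + 1))) R
          (Matrix.det (g : Matrix (Fin 2) (Fin 2) (ZMod (5 ^ (m + 1))))) := by
      rw [RingHom.map_det]; rfl
    rw [hd, ← map_pow, hg, map_one]

end intcast

end Summit.BirchSwinnertonDyer.BirchSwinnertonDyer.Theorems.GL2F5AdjointBricks
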